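import Summits.Ventures.CertifiedManyBodySolver.Upper.IntervalReaderQuadDGamma
import Summits.Ventures.CertifiedManyBodySolver.Upper.GaugedShibaNambuEntries

/-!
# Ventures/CertifiedManyBodySolver — Upper/IntervalReaderSourcedBoxKernel.lean: the W5 sourced box through the `l3core-sgf` automaton
(part 22 of the Theorem-H1′ package; parts 1–21: `IntervalReaderSchur` … `IntervalReaderQuadDGamma`)

HONEST FRAMING: first certified bounds; not a superconductivity verdict; every number certified or labelled
float.  A sourced-Hamiltonian upper is a certified variational ENERGY CEILING for `H − μN − h(Δ_d + Δ_d†)`, never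
a sign of order; this file certifies no number and moves no row.

THE W5 CAPSTONE (energy sentence).  In both transformed frames of the tree — Lieb's `W = partialParticleHole D↓`
(part 11, `Upper/SourcedBoxNodeOfTransformedWitness`) and the PRODUCERS' frame `S′ = W · orbitalPhase g` with a real
sign gauge (`Upper/ProducersFrameSourcedBoxNode`, `gaugedShiba'_conjTranspose_conj_dWaveSourceOpenBox`) — the
transformed sourced box is `dΓ(M) − μ·ab·1 + U (N_↑ − Σ n_↑n_↓)` for a SYMMETRIC one-body matrix `M`.  With parts
19–21 the Rayleigh numerator of that operator on the FORMAT-mpsgf1 witness IS the `(START, FINAL)` target of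
ird-3's multi-state `l3core-sgf` sweep:

* `inner_quadratic_eq_quadWordSum` — for ANY symmetric `M` on `Orb (Fin a ×ₗ Fin b)`, a MONOTONE enumeration `e`
  and `ψ̃ = toSpinVec⁻¹ Ψ`, `Ψ k = mpsOpenVar (a·b) A l r (k ∘ e)`:
  `star ψ̃ ⬝ᵥ ((dΓ(M) − μ·ab·1 + U(N_↑ − Σ n_↑n_↓)) *ᵥ ψ̃) = star ψ ⬝ᵥ (quadWordSum (dGammaHop (orbPullback e M)) 0 (quadOnSite M U μ e) *ᵥ ψ)`
  with the on-site words `quadOnSite` = intra-site part of `dΓ` + `U • (n_↑ − n_↑n_↓)` + `[k = 0](−μ·ab) • 1` (the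
  constant at site `0`, where `sgf_model` puts `C`);
* `quadratic_sentence_of_reader` — bytes of the sgf `H`-sweep over `quadAutomaton` with these weights and of the
  `Nrm`-sweep + the by-value ACCEPT test ⟹ `Re (star ψ̃ ⬝ᵥ ((dΓ(M) − μ·ab·1 + U(N_↑ − Σ n_↑n_↓)) *ᵥ ψ̃)) ≤ E · Re (star ψ̃ ⬝ᵥ ψ̃)`;
* `bdgNambuMatrix_dWave_symm` + `sourcedBox_sentence_of_reader` — Lieb frame: `M = 𝓗 = bdgNambuMatrix (−[p∼q]) (−h·w_C) μ`
  is symmetric (real pair weights), and the sentence is the `hE` of `sourcedBoxNode_of_transformedWitness`;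
* `gaugedNambu_symm_of_sign` + `producersSourcedBox_sentence_of_reader` — producers' frame: `M = (ḡ_i g_j 𝓗_ij)` is
  symmetric for a real sign gauge `g i = ±1`, and the sentence is the energy hypothesis of
  `sourcedBoxNode_of_producersRows` (its density-window rows `Ñ_phys` are on-site word sums = `quadWordSum 0 0 V`,
  read the same way; not restated here).
-/

noncomputable section

open Matrix Finset WithLp
open scoped BigOperators ComplexOrder Matrix.Norms.L2Operator

namespace Summit.Ventures.CertifiedManyBodySolver.Upper.IntervalReader

open Literature.MathematicalPhysics.QuantumLattice
open Literature.MathematicalPhysics.QuantumLattice.JordanWigner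

section Quadratic

variable {a b D : ℕ}

/-- The on-site words of `sgf_model` for `dΓ(M) − μ·ab·1 + U(N_↑ − Σ n_↑n_↓)` read along `e`: the intra-site part of
`dΓ`, `U • (n_↑ − n_↑n_↓)`, and the constant `−μ·ab` at site `0`. -/
def quadOnSite (M : Matrix (Orb (Fin a ×ₗ Fin b)) (Orb (Fin a ×ₗ Fin b)) ℂ) (U μ : ℝ)
    (e : Fin (a * b) ≃ (Fin a ×ₗ Fin b)) (k : Fin (a * b)) : Matrix (Fin 4) (Fin 4) ℂ :=
  dGammaOnSite (orbPullback e M) k +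
    ((U : ℂ) • (siteNumber 0 - siteDouble) + if (k : ℕ) = 0 then (-((μ : ℂ) * ((a : ℂ) * (b : ℂ)))) • 1 else 0)

/-- The constant placed at site `0` sums to the constant (both vanish when there is no site). -/
theorem sum_ite_val_zero (c : ℂ) (hc : a * b = 0 → c = 0) :
    ∑ k : Fin (a * b), (if (k : ℕ) = 0 then c else 0) = c := by
  by_cases hN : a * b = 0
  · haveI : IsEmpty (Fin (a * b)) := ⟨fun k => absurd k.2 (by omega)⟩
    rw [Finset.univ_eq_empty, Finset.sum_empty, hc hN]
  · have h0 : 0 < a * b := Nat.pos_of_ne_zero hN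
    rw [Finset.sum_eq_single (⟨0, h0⟩ : Fin (a * b))]
    · simp
    · intro k _ hk
      rw [if_neg (fun h' => hk (Fin.ext h'))]
    · intro h'; exact absurd (Finset.mem_univ _) h'

/-- **The transformed quadratic operator's Rayleigh numerator IS the `l3core-sgf` word sum's matrix element**
(symmetric `M`, monotone enumeration). -/
theorem inner_quadratic_eq_quadWordSum (M : Matrix (Orb (Fin a ×ₗ Fin b)) (Orb (Fin a ×ₗ Fin b)) ℂ)
    (hM : ∀ i j, M i j = M j i) (U μ : ℝ) (e : Fin (a * b) ≃ (Fin a ×ₗ Fin b)) (he : ∀ i j, e i < e j ↔ i < j)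
    (A : Fin (a * b) → MPSTensor 4 D) (l r : Fin D → ℂ) :
    let Ψ : TensorIndex (Fin a ×ₗ Fin b) 4 → ℂ := fun k => mpsOpenVar (a * b) A l r (fun i => k (e i))
    star (toSpinVec.symm Ψ) ⬝ᵥ
        ((dGamma M - ((μ : ℂ) * ((a : ℂ) * (b : ℂ))) •
            (1 : Matrix (Finset (Orb (Fin a ×ₗ Fin b))) (Finset (Orb (Fin a ×ₗ Fin b))) ℂ) +
          (U : ℂ) • ((∑ x : Fin a ×ₗ Fin b, numberOp x 0) -
            ∑ x : Fin a ×ₗ Fin b, numberOp x 0 * numberOp x 1)) *ᵥ toSpinVec.symm Ψ) =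
      star (mpsOpenVar (a * b) A l r) ⬝ᵥ
        (quadWordSum (dGammaHop (orbPullback e M)) (fun _ _ _ _ => 0) (quadOnSite M U μ e) *ᵥ
          mpsOpenVar (a * b) A l r) := by
  intro Ψ
  -- Fock side → spin side, term by term
  have hconv : ∀ X : Matrix (Finset (Orb (Fin a ×ₗ Fin b))) (Finset (Orb (Fin a ×ₗ Fin b))) ℂ,
      star (toSpinVec.symm Ψ) ⬝ᵥ (X *ᵥ toSpinVec.symm Ψ) = star Ψ ⬝ᵥ (toSpin X *ᵥ Ψ) := fun X => by
    rw [← star_toSpinVec_dotProduct, ← toSpin_mulVec, LinearEquiv.apply_symm_apply]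
  have hnorm : star (toSpinVec.symm Ψ) ⬝ᵥ toSpinVec.symm Ψ = star Ψ ⬝ᵥ Ψ := by
    rw [← star_toSpinVec_dotProduct, LinearEquiv.apply_symm_apply]
  rw [add_mulVec, sub_mulVec, dotProduct_add, dotProduct_sub, smul_mulVec, one_mulVec, dotProduct_smul, smul_eq_mul,
    smul_mulVec, dotProduct_smul, smul_eq_mul, sub_mulVec, dotProduct_sub, Matrix.sum_mulVec, Matrix.sum_mulVec,
    dotProduct_sum, dotProduct_sum]
  simp only [hconv, hnorm]
  -- (1) one-body term: relabel to the chain; (2) norm; (3) densities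
  rw [inner_toSpin_dGamma_relabel e he, star_compEquiv_dotProduct]
  have hup : (∑ x : Fin a ×ₗ Fin b, star Ψ ⬝ᵥ (toSpin (numberOp x 0) *ᵥ Ψ)) =
      ∑ k : Fin (a * b), star (mpsOpenVar (a * b) A l r) ⬝ᵥ
        ((onSite k (siteNumber 0) : Op (Fin (a * b)) 4) *ᵥ mpsOpenVar (a * b) A l r) := by
    rw [← Fintype.sum_equiv e (fun k => star Ψ ⬝ᵥ (toSpin (numberOp (e k) 0) *ᵥ Ψ)) _ (fun _ => rfl)]
    refine Finset.sum_congr rfl fun k _ => ?_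
    rw [toSpin_numberOp_eq_productOp, inner_productOp_compEquiv, update_comp_equiv, ← onSite_eq_productOp]
  have hdocc : (∑ x : Fin a ×ₗ Fin b, star Ψ ⬝ᵥ (toSpin (numberOp x 0 * numberOp x 1) *ᵥ Ψ)) =
      ∑ k : Fin (a * b), star (mpsOpenVar (a * b) A l r) ⬝ᵥ
        ((onSite k siteDouble : Op (Fin (a * b)) 4) *ᵥ mpsOpenVar (a * b) A l r) := by
    rw [← Fintype.sum_equiv e (fun k => star Ψ ⬝ᵥ (toSpin (numberOp (e k) 0 * numberOp (e k) 1) *ᵥ Ψ)) _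
      (fun _ => rfl)]
    refine Finset.sum_congr rfl fun k _ => ?_
    rw [toSpin_numberOp_mul_numberOp_eq_productOp, inner_productOp_compEquiv, update_comp_equiv, ← onSite_eq_productOp]
  rw [hup, hdocc]
  -- the word sum, split into `dΓ` + extra on-site words
  have hV : quadOnSite M U μ e = fun k => dGammaOnSite (orbPullback e M) k +
      ((U : ℂ) • (siteNumber 0 - siteDouble) + if (k : ℕ) = 0 then (-((μ : ℂ) * ((a : ℂ) * (b : ℂ)))) • 1 else 0) :=
    rfl
  rw [hV, quadWordSum_add_onSite, ← toSpin_dGamma_eq_quadWordSum _ (orbPullback_symm e _ hM), add_mulVec,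
    dotProduct_add, Matrix.sum_mulVec, dotProduct_sum]
  have hsite : ∀ k : Fin (a * b), star (mpsOpenVar (a * b) A l r) ⬝ᵥ
      ((onSite k (((U : ℂ) • (siteNumber 0 - siteDouble) +
          if (k : ℕ) = 0 then (-((μ : ℂ) * ((a : ℂ) * (b : ℂ)))) • 1 else 0)) : Op (Fin (a * b)) 4) *ᵥ
        mpsOpenVar (a * b) A l r) =
      (U : ℂ) * (star (mpsOpenVar (a * b) A l r) ⬝ᵥ
          ((onSite k (siteNumber 0) : Op (Fin (a * b)) 4) *ᵥ mpsOpenVar (a * b) A l r)) -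
        (U : ℂ) * (star (mpsOpenVar (a * b) A l r) ⬝ᵥ
          ((onSite k siteDouble : Op (Fin (a * b)) 4) *ᵥ mpsOpenVar (a * b) A l r)) +
        (if (k : ℕ) = 0 then (-((μ : ℂ) * ((a : ℂ) * (b : ℂ)))) else 0) *
          (star (mpsOpenVar (a * b) A l r) ⬝ᵥ mpsOpenVar (a * b) A l r) := by
    intro k
    by_cases hk : (k : ℕ) = 0
    · simp only [hk, if_true, onSite_add', onSite_smul', onSite_sub', onSite_one', add_mulVec, sub_mulVec,
        smul_mulVec, one_mulVec, dotProduct_add, dotProduct_sub, dotProduct_smul, smul_eq_mul]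
      ring
    · simp only [hk, if_false, add_zero, onSite_smul', onSite_sub', sub_mulVec, smul_mulVec, dotProduct_sub,
        dotProduct_smul, smul_eq_mul, zero_mul]
      ring
  simp only [hsite, Finset.sum_add_distrib, Finset.sum_sub_distrib, ← Finset.mul_sum, ← Finset.sum_mul]
  rw [sum_ite_val_zero _ (fun h0 => by
    rw [show ((a : ℂ) * (b : ℂ)) = ((a * b : ℕ) : ℂ) by push_cast; ring, h0]; simp)]
  ring

/-- **Bytes of the `l3core-sgf` reader ⇒ the transformed energy sentence** (any symmetric `M`, monotone `e`):
`H`-sweep over `quadAutomaton (dGammaHop (orbPullback e M)) 0 (quadOnSite M U μ e)` + `Nrm`-sweep with part 12's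
per-step hypotheses + the by-value ACCEPT test ⟹ `Re ⟨ψ̃, (dΓ(M) − μ·ab·1 + U(N_↑ − Σ n_↑n_↓)) ψ̃⟩ ≤ E · Re ⟨ψ̃, ψ̃⟩`. -/
theorem quadratic_sentence_of_reader (M : Matrix (Orb (Fin a ×ₗ Fin b)) (Orb (Fin a ×ₗ Fin b)) ℂ)
    (hM : ∀ i j, M i j = M j i) (U μ : ℝ) (e : Fin (a * b) ≃ (Fin a ×ₗ Fin b))
    (he : ∀ i j, e i < e j ↔ i < j) (A : Fin (a * b) → MPSTensor 4 D) (l r : Fin D → ℂ)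
    (κ : Fin (a * b) → ℝ) (hκ0 : ∀ k, 0 ≤ κ k)
    (hκ : ∀ k (z : EuclideanSpace ℂ (Fin D)), ∑ s, ‖toLp 2 (A k s *ᵥ ofLp z)‖ ^ 2 ≤ κ k * ‖z‖ ^ 2)
    (Mo : Fin (a * b) → QState (a * b) → QState (a * b) → ℝ) (hM0 : ∀ k b' c, 0 ≤ Mo k b' c)
    (hMrow : ∀ k b' c s, ∑ s', ‖quadAutomaton (dGammaHop (orbPullback e M)) (fun _ _ _ _ => 0)
      (quadOnSite M U μ e) k b' c s s'‖ ≤ Mo k b' c)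
    (hMcol : ∀ k b' c s', ∑ s, ‖quadAutomaton (dGammaHop (orbPullback e M)) (fun _ _ _ _ => 0)
      (quadOnSite M U μ e) k b' c s s'‖ ≤ Mo k b' c)
    (YH : Fin (a * b + 1) → QState (a * b) → Matrix (Fin D) (Fin D) ℂ) (ρH : Fin (a * b) → QState (a * b) → ℝ)
    (hρH : ∀ (k : Fin (a * b)) (c : QState (a * b)),
      ‖YH k.succ c - ∑ b', transferOp (A k) (quadAutomaton (dGammaHop (orbPullback e M)) (fun _ _ _ _ => 0)
        (quadOnSite M U μ e) k b' c) (YH k.castSucc b')‖ ≤ ρH k c)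
    (radH : Fin (a * b + 1) → QState (a * b) → ℝ)
    (hrH0 : ∀ b', ‖YH 0 b' -
      (Pi.single QState.start (vecMulVec (star l) l) : QState (a * b) → Matrix (Fin D) (Fin D) ℂ) b'‖ ≤ radH 0 b')
    (hrH : ∀ (k : Fin (a * b)) (c : QState (a * b)),
      ∑ b', Mo k b' c * κ k * radH k.castSucc b' + ρH k c ≤ radH k.succ c)
    (YN : Fin (a * b + 1) → Matrix (Fin D) (Fin D) ℂ) (ρN : Fin (a * b) → ℝ)
    (hρN : ∀ k : Fin (a * b), ‖YN k.succ - transferOp (A k) 1 (YN k.castSucc)‖ ≤ ρN k)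
    (radN : Fin (a * b + 1) → ℝ) (hrN0 : ‖YN 0 - vecMulVec (star l) l‖ ≤ radN 0)
    (hrN : ∀ k : Fin (a * b), 1 * κ k * radN k.castSucc + ρN k ≤ radN k.succ)
    (E : ℝ)
    (hlo : (star r ⬝ᵥ (YH (Fin.last (a * b)) QState.fin *ᵥ r)).re +
        (∑ i, ‖r i‖) * (∑ i, ‖r i‖) * radH (Fin.last (a * b)) QState.fin ≤
      E * ((star r ⬝ᵥ (YN (Fin.last (a * b)) *ᵥ r)).re - (∑ i, ‖r i‖) * (∑ i, ‖r i‖) * radN (Fin.last (a * b))))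
    (hhi : (star r ⬝ᵥ (YH (Fin.last (a * b)) QState.fin *ᵥ r)).re +
        (∑ i, ‖r i‖) * (∑ i, ‖r i‖) * radH (Fin.last (a * b)) QState.fin ≤
      E * ((star r ⬝ᵥ (YN (Fin.last (a * b)) *ᵥ r)).re + (∑ i, ‖r i‖) * (∑ i, ‖r i‖) * radN (Fin.last (a * b)))) :
    let Ψ : TensorIndex (Fin a ×ₗ Fin b) 4 → ℂ := fun k => mpsOpenVar (a * b) A l r (fun i => k (e i))
    (star (toSpinVec.symm Ψ) ⬝ᵥ
        ((dGamma M - ((μ : ℂ) * ((a : ℂ) * (b : ℂ))) •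
            (1 : Matrix (Finset (Orb (Fin a ×ₗ Fin b))) (Finset (Orb (Fin a ×ₗ Fin b))) ℂ) +
          (U : ℂ) • ((∑ x : Fin a ×ₗ Fin b, numberOp x 0) -
            ∑ x : Fin a ×ₗ Fin b, numberOp x 0 * numberOp x 1)) *ᵥ toSpinVec.symm Ψ)).re ≤
      E * (star (toSpinVec.symm Ψ) ⬝ᵥ toSpinVec.symm Ψ).re := by
  intro Ψ
  have hEq := inner_quadratic_eq_quadWordSum M hM U μ e he A l r
  have hNq : star (toSpinVec.symm Ψ) ⬝ᵥ toSpinVec.symm Ψ =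
      star (mpsOpenVar (a * b) A l r) ⬝ᵥ mpsOpenVar (a * b) A l r := by
    rw [← star_toSpinVec_dotProduct, LinearEquiv.apply_symm_apply, star_compEquiv_dotProduct]
  rw [hEq, hNq]
  have hH := reader_encloses_quadWordSum_element (dGammaHop (orbPullback e M)) (fun _ _ _ _ => 0)
    (quadOnSite M U μ e) A κ hκ0 hκ Mo hM0 hMrow hMcol l l r r YH ρH hρH radH hrH0 hrH
  have hNrm := reader_encloses_productOp_element (a * b) A (fun _ => (1 : Matrix (Fin 4) (Fin 4) ℂ)) κ hκ0 hκ
    (fun _ => (1 : ℝ)) (fun _ => zero_le_one) (fun _ s => (sum_norm_one_apply_row s).le)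
    (fun _ s' => (sum_norm_one_apply_col s').le) (1 : Op (Fin (a * b)) 4) one_apply_eq_prod_one l l r r YN ρN
    hρN radN hrN0 hrN
  rw [Matrix.one_mulVec] at hNrm
  have hA := abs_re_sub_re_le_of_norm_sub_le hH
  have hB := abs_re_sub_re_le_of_norm_sub_le hNrm
  rw [← one_mul ((star (mpsOpenVar (a * b) A l r) ⬝ᵥ
    (quadWordSum (dGammaHop (orbPullback e M)) (fun _ _ _ _ => 0) (quadOnSite M U μ e) *ᵥ
      mpsOpenVar (a * b) A l r)).re)] at hA
  rw [← one_mul E] at hlo hhi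
  exact accept_sound one_pos hB hA hlo hhi

end Quadratic

/-! ## §MM  The two frames of the tree -/

section Frames

variable {a b : ℕ}

/-- The transformed one-body matrix of the W5 object in Lieb's frame (`partialParticleHole_conj_dWaveSourceOpenBox`). -/
abbrev w5Nambu (a b : ℕ) (μ h : ℝ) : Matrix (Orb (Fin a ×ₗ Fin b)) (Orb (Fin a ×ₗ Fin b)) ℂ :=
  bdgNambuMatrix (fun x y : Fin a ×ₗ Fin b => if (rectBoxGraph a b).Adj x y then -(1 : ℂ) else 0)
    (fun u v : Fin a ×ₗ Fin b => -(h : ℂ) * dWaveBoxPairWeight a b (u, v)) μ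

/-- **The W5 Nambu matrix is symmetric** (symmetric bonds; real, symmetric pair weights). -/
theorem bdgNambuMatrix_dWave_symm (μ h : ℝ) (i j : Orb (Fin a ×ₗ Fin b)) :
    w5Nambu a b μ h i j = w5Nambu a b μ h j i := by
  have hi : i = orb (ofLex i).1 (ofLex i).2 := rfl
  have hj : j = orb (ofLex j).1 (ofLex j).2 := rfl
  rw [hi, hj, w5Nambu, bdgNambuMatrix_orb_orb, bdgNambuMatrix_orb_orb]
  have hadj : (rectBoxGraph a b).Adj (ofLex j).1 (ofLex i).1 ↔ (rectBoxGraph a b).Adj (ofLex i).1 (ofLex j).1 :=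
    ⟨fun h' => h'.symm, fun h' => h'.symm⟩
  have hw : dWaveBoxPairWeight a b ((ofLex j).1, (ofLex i).1) = dWaveBoxPairWeight a b ((ofLex i).1, (ofLex j).1) :=
    dWaveBoxPairWeight_symm a b _ _
  have hreal : star (dWaveBoxPairWeight a b ((ofLex i).1, (ofLex j).1)) =
      dWaveBoxPairWeight a b ((ofLex i).1, (ofLex j).1) := star_dWaveBoxPairWeight a b _
  have hstar : star (-(h : ℂ) * dWaveBoxPairWeight a b ((ofLex i).1, (ofLex j).1) +
        -(h : ℂ) * dWaveBoxPairWeight a b ((ofLex i).1, (ofLex j).1)) =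
      -(h : ℂ) * dWaveBoxPairWeight a b ((ofLex i).1, (ofLex j).1) +
        -(h : ℂ) * dWaveBoxPairWeight a b ((ofLex i).1, (ofLex j).1) := by
    rw [star_add, star_mul', star_neg, hreal, Complex.star_def, Complex.conj_ofReal]
  by_cases hs : (ofLex i).2 = 0 <;> by_cases hs' : (ofLex j).2 = 0 <;>
    simp only [hs, hs', if_true, if_false, hadj, hw, @eq_comm _ (ofLex j).1 (ofLex i).1, hstar]

/-- **The producers' gauged matrix is symmetric** for a real sign gauge `g i = ±1`. -/
theorem gaugedNambu_symm_of_sign (μ h : ℝ) {g : Orb (Fin a ×ₗ Fin b) → ℂ} (hg : ∀ i, g i = 1 ∨ g i = -1)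
    (i j : Orb (Fin a ×ₗ Fin b)) :
    (Matrix.of fun i j => star (g i) * g j * w5Nambu a b μ h i j) i j =
      (Matrix.of fun i j => star (g i) * g j * w5Nambu a b μ h i j) j i := by
  have hreal : ∀ i, star (g i) = g i := fun i => by
    rcases hg i with h1 | h1 <;> simp [h1]
  rw [Matrix.of_apply, Matrix.of_apply, hreal, hreal, bdgNambuMatrix_dWave_symm μ h i j]
  ring

end Frames

section Sentences

variable {a b D : ℕ}

/-- **Lieb frame — the `hE` of `sourcedBoxNode_of_transformedWitness` from the sgf reader's bytes.** -/
theorem sourcedBox_sentence_of_reader (U μ h : ℝ) (e : Fin (a * b) ≃ (Fin a ×ₗ Fin b))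
    (he : ∀ i j, e i < e j ↔ i < j) (A : Fin (a * b) → MPSTensor 4 D) (l r : Fin D → ℂ)
    (κ : Fin (a * b) → ℝ) (hκ0 : ∀ k, 0 ≤ κ k)
    (hκ : ∀ k (z : EuclideanSpace ℂ (Fin D)), ∑ s, ‖toLp 2 (A k s *ᵥ ofLp z)‖ ^ 2 ≤ κ k * ‖z‖ ^ 2)
    (Mo : Fin (a * b) → QState (a * b) → QState (a * b) → ℝ) (hM0 : ∀ k b' c, 0 ≤ Mo k b' c)
    (hMrow : ∀ k b' c s, ∑ s', ‖quadAutomaton (dGammaHop (orbPullback e (w5Nambu a b μ h))) (fun _ _ _ _ => 0)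
      (quadOnSite (w5Nambu a b μ h) U μ e) k b' c s s'‖ ≤ Mo k b' c)
    (hMcol : ∀ k b' c s', ∑ s, ‖quadAutomaton (dGammaHop (orbPullback e (w5Nambu a b μ h))) (fun _ _ _ _ => 0)
      (quadOnSite (w5Nambu a b μ h) U μ e) k b' c s s'‖ ≤ Mo k b' c)
    (YH : Fin (a * b + 1) → QState (a * b) → Matrix (Fin D) (Fin D) ℂ) (ρH : Fin (a * b) → QState (a * b) → ℝ)
    (hρH : ∀ (k : Fin (a * b)) (c : QState (a * b)),
      ‖YH k.succ c - ∑ b', transferOp (A k) (quadAutomaton (dGammaHop (orbPullback e (w5Nambu a b μ h)))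
        (fun _ _ _ _ => 0) (quadOnSite (w5Nambu a b μ h) U μ e) k b' c) (YH k.castSucc b')‖ ≤ ρH k c)
    (radH : Fin (a * b + 1) → QState (a * b) → ℝ)
    (hrH0 : ∀ b', ‖YH 0 b' -
      (Pi.single QState.start (vecMulVec (star l) l) : QState (a * b) → Matrix (Fin D) (Fin D) ℂ) b'‖ ≤ radH 0 b')
    (hrH : ∀ (k : Fin (a * b)) (c : QState (a * b)),
      ∑ b', Mo k b' c * κ k * radH k.castSucc b' + ρH k c ≤ radH k.succ c)
    (YN : Fin (a * b + 1) → Matrix (Fin D) (Fin D) ℂ) (ρN : Fin (a * b) → ℝ)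
    (hρN : ∀ k : Fin (a * b), ‖YN k.succ - transferOp (A k) 1 (YN k.castSucc)‖ ≤ ρN k)
    (radN : Fin (a * b + 1) → ℝ) (hrN0 : ‖YN 0 - vecMulVec (star l) l‖ ≤ radN 0)
    (hrN : ∀ k : Fin (a * b), 1 * κ k * radN k.castSucc + ρN k ≤ radN k.succ)
    (E : ℝ)
    (hlo : (star r ⬝ᵥ (YH (Fin.last (a * b)) QState.fin *ᵥ r)).re +
        (∑ i, ‖r i‖) * (∑ i, ‖r i‖) * radH (Fin.last (a * b)) QState.fin ≤
      E * ((star r ⬝ᵥ (YN (Fin.last (a * b)) *ᵥ r)).re - (∑ i, ‖r i‖) * (∑ i, ‖r i‖) * radN (Fin.last (a * b))))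
    (hhi : (star r ⬝ᵥ (YH (Fin.last (a * b)) QState.fin *ᵥ r)).re +
        (∑ i, ‖r i‖) * (∑ i, ‖r i‖) * radH (Fin.last (a * b)) QState.fin ≤
      E * ((star r ⬝ᵥ (YN (Fin.last (a * b)) *ᵥ r)).re + (∑ i, ‖r i‖) * (∑ i, ‖r i‖) * radN (Fin.last (a * b)))) :
    let Ψ : TensorIndex (Fin a ×ₗ Fin b) 4 → ℂ := fun k => mpsOpenVar (a * b) A l r (fun i => k (e i))
    (star (toSpinVec.symm Ψ) ⬝ᵥ
        (((partialParticleHole (spinDownOrbitals : Finset (Orb (Fin a ×ₗ Fin b))))ᴴ *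
            dWaveSourceOpenBox a b U μ h *
            partialParticleHole (spinDownOrbitals : Finset (Orb (Fin a ×ₗ Fin b)))) *ᵥ toSpinVec.symm Ψ)).re ≤
      E * (star (toSpinVec.symm Ψ) ⬝ᵥ toSpinVec.symm Ψ).re := by
  intro Ψ
  rw [partialParticleHole_conjTranspose_conj_eq, partialParticleHole_conj_dWaveSourceOpenBox]
  exact quadratic_sentence_of_reader (w5Nambu a b μ h) (bdgNambuMatrix_dWave_symm μ h) U μ e he A l r κ hκ0 hκ Mo
    hM0 hMrow hMcol YH ρH hρH radH hrH0 hrH YN ρN hρN radN hrN0 hrN E hlo hhi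

/-- **Producers' frame — the energy hypothesis of `sourcedBoxNode_of_producersRows` from the sgf reader's bytes**
(real sign gauge `g i = ±1`, e.g. the production `g(r↓) = (−1)^{x+y}`, `g(r↑) = 1`). -/
theorem producersSourcedBox_sentence_of_reader (U μ h : ℝ) {g : Orb (Fin a ×ₗ Fin b) → ℂ}
    (hg : ∀ i, g i = 1 ∨ g i = -1) (e : Fin (a * b) ≃ (Fin a ×ₗ Fin b))
    (he : ∀ i j, e i < e j ↔ i < j) (A : Fin (a * b) → MPSTensor 4 D) (l r : Fin D → ℂ)
    (κ : Fin (a * b) → ℝ) (hκ0 : ∀ k, 0 ≤ κ k)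
    (hκ : ∀ k (z : EuclideanSpace ℂ (Fin D)), ∑ s, ‖toLp 2 (A k s *ᵥ ofLp z)‖ ^ 2 ≤ κ k * ‖z‖ ^ 2)
    (Mo : Fin (a * b) → QState (a * b) → QState (a * b) → ℝ) (hM0 : ∀ k b' c, 0 ≤ Mo k b' c)
    (hMrow : ∀ k b' c s, ∑ s', ‖quadAutomaton (dGammaHop (orbPullback e
      (Matrix.of fun i j => star (g i) * g j * w5Nambu a b μ h i j))) (fun _ _ _ _ => 0)
      (quadOnSite (Matrix.of fun i j => star (g i) * g j * w5Nambu a b μ h i j) U μ e) k b' c s s'‖ ≤ Mo k b' c)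
    (hMcol : ∀ k b' c s', ∑ s, ‖quadAutomaton (dGammaHop (orbPullback e
      (Matrix.of fun i j => star (g i) * g j * w5Nambu a b μ h i j))) (fun _ _ _ _ => 0)
      (quadOnSite (Matrix.of fun i j => star (g i) * g j * w5Nambu a b μ h i j) U μ e) k b' c s s'‖ ≤ Mo k b' c)
    (YH : Fin (a * b + 1) → QState (a * b) → Matrix (Fin D) (Fin D) ℂ) (ρH : Fin (a * b) → QState (a * b) → ℝ)
    (hρH : ∀ (k : Fin (a * b)) (c : QState (a * b)),
      ‖YH k.succ c - ∑ b', transferOp (A k) (quadAutomaton (dGammaHop (orbPullback e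
        (Matrix.of fun i j => star (g i) * g j * w5Nambu a b μ h i j))) (fun _ _ _ _ => 0)
        (quadOnSite (Matrix.of fun i j => star (g i) * g j * w5Nambu a b μ h i j) U μ e) k b' c)
        (YH k.castSucc b')‖ ≤ ρH k c)
    (radH : Fin (a * b + 1) → QState (a * b) → ℝ)
    (hrH0 : ∀ b', ‖YH 0 b' -
      (Pi.single QState.start (vecMulVec (star l) l) : QState (a * b) → Matrix (Fin D) (Fin D) ℂ) b'‖ ≤ radH 0 b')
    (hrH : ∀ (k : Fin (a * b)) (c : QState (a * b)),
      ∑ b', Mo k b' c * κ k * radH k.castSucc b' + ρH k c ≤ radH k.succ c)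
    (YN : Fin (a * b + 1) → Matrix (Fin D) (Fin D) ℂ) (ρN : Fin (a * b) → ℝ)
    (hρN : ∀ k : Fin (a * b), ‖YN k.succ - transferOp (A k) 1 (YN k.castSucc)‖ ≤ ρN k)
    (radN : Fin (a * b + 1) → ℝ) (hrN0 : ‖YN 0 - vecMulVec (star l) l‖ ≤ radN 0)
    (hrN : ∀ k : Fin (a * b), 1 * κ k * radN k.castSucc + ρN k ≤ radN k.succ)
    (E : ℝ)
    (hlo : (star r ⬝ᵥ (YH (Fin.last (a * b)) QState.fin *ᵥ r)).re +
        (∑ i, ‖r i‖) * (∑ i, ‖r i‖) * radH (Fin.last (a * b)) QState.fin ≤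
      E * ((star r ⬝ᵥ (YN (Fin.last (a * b)) *ᵥ r)).re - (∑ i, ‖r i‖) * (∑ i, ‖r i‖) * radN (Fin.last (a * b))))
    (hhi : (star r ⬝ᵥ (YH (Fin.last (a * b)) QState.fin *ᵥ r)).re +
        (∑ i, ‖r i‖) * (∑ i, ‖r i‖) * radH (Fin.last (a * b)) QState.fin ≤
      E * ((star r ⬝ᵥ (YN (Fin.last (a * b)) *ᵥ r)).re + (∑ i, ‖r i‖) * (∑ i, ‖r i‖) * radN (Fin.last (a * b)))) :
    let Ψ : TensorIndex (Fin a ×ₗ Fin b) 4 → ℂ := fun k => mpsOpenVar (a * b) A l r (fun i => k (e i))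
    (star (toSpinVec.symm Ψ) ⬝ᵥ
        (((partialParticleHole (spinDownOrbitals : Finset (Orb (Fin a ×ₗ Fin b))) * orbitalPhase g)ᴴ *
            dWaveSourceOpenBox a b U μ h *
            (partialParticleHole (spinDownOrbitals : Finset (Orb (Fin a ×ₗ Fin b))) * orbitalPhase g)) *ᵥ
          toSpinVec.symm Ψ)).re ≤
      E * (star (toSpinVec.symm Ψ) ⬝ᵥ toSpinVec.symm Ψ).re := by
  intro Ψ
  have hg' : ∀ i, ‖g i‖ = 1 := fun i => by rcases hg i with h1 | h1 <;> simp [h1]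
  rw [gaugedShiba'_conjTranspose_conj_dWaveSourceOpenBox (a := a) (b := b) U μ h hg']
  exact quadratic_sentence_of_reader _ (gaugedNambu_symm_of_sign μ h hg) U μ e he A l r κ hκ0 hκ Mo hM0 hMrow hMcol
    YH ρH hρH radH hrH0 hrH YN ρN hρN radN hrN0 hrN E hlo hhi

end Sentences

end Summit.Ventures.CertifiedManyBodySolver.Upper.IntervalReader

end
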